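import Summits.CriticalPhenomena.PercolationContinuityZ3.Theorems.PercNearOneGluingNoHeavyLowerTailKnQuestion9Hub
import Summits.CriticalPhenomena.PercolationContinuityZ3.Theorems.PercNearOneGluingNoHeavyLowerTailKNQuestion7AllRelays
import HarnessLib

/-!
# Kozma–Nitzan's Question 9 at a sure observer with ONE neighbour is Question 7 (base case of the sure-observer reduction)

Support file (lemma factory `prim-lf-1` gen 11; `--supports stmt-CriticalPhenomena-4575`).  No definitions, no named facts, no sorries.

`…KnQuestion9SureObserver.lean` (`KnQ9Sure.question9_iff_sureObserver`) reduces Question 9 (arXiv:2401.12397 p. 36) to observers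
all of whose pairs have weight `0` or `1`, i.e. to the hub `g` of prim-lf-2's one-block hub graph `hubWeight w (sides S ∅)` (a new
vertex glued surely onto a vertex set `S` of `G`; `…KnQuestion9Hub.lean`).  Here: the case `S = {v}`.  The Question-9 designation at
the hub is the reliability order of `G` itself (`KnQ9Hub.real_restrW_hub`), a path between two old vertices through a hub of degree
one re-enters at `v` and can be cut out (`KnQ9Hub.reachable_inl_iff` with `S = {v}`), so the two probabilities of (41) at the hub are
those of (41) at `v` in `G` — and that is Question 7 at `v`, a theorem of the tree (`Q7Psi.kn_question7_fintype`, via CSH).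
* `KnQ9Sure.question9_hub_singleton` — (41) at the hub over `S = {v}` for every relay `a ∈ A` that minimises `P_G(· ↔ b)`;
* `KnQ9Sure.question9_hub_singleton'` — the same with the designation hypothesis in the Question-9 shape (`restrW {g}ᶜ`).
So the first open case of Question 9 is a hub glued onto two vertices.
[cite: KozmaNitzan2024, Questions 7 and 9 (§5.5 p. 36)]
-/

noncomputable section

namespace Summit.CriticalPhenomena.PercolationContinuityZ3.Theorems

open MeasureTheory Set Literature.Probability.LatticeModels Literature.Probability.Percolation
open Literature.Probability.Percolation.TwoSetConditionalAssociation KnQ9Hub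

namespace KnQ9Sure

variable {V : Type*} [Fintype V]

/-- **Question 9 at a hub glued to one vertex.**  In the one-block hub graph over `S = {v}` (hub `g = inr true` joined to `v` by a
sure pair), for every `a ∈ A` minimising `P_G(· ↔ b)` over `A`:  `P(a ↔ b, g ↔ A) ≤ P(g ↔ b, g ↔ A)`.  (Both sides are the sides of
(41) at `v` in `G`, and that is Question 7 at `v`.) [cite: KozmaNitzan2024, Questions 7 and 9 (§5.5 p. 36)] -/
theorem question9_hub_singleton (w : Sym2 V → unitInterval) (A : Finset V) (v b a : V) (haA : a ∈ A)
    (hmin : ∀ a' ∈ A, (prodBernoulli w).real (openConn a b) ≤ (prodBernoulli w).real (openConn a' b)) :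
    (prodBernoulli (hubWeight w (sides ({v} : Set V) ∅))).real
        (openConn (Sum.inl a) (Sum.inl b) ∩ SoloBlindKN.connTo (Sum.inr true) (A.map Function.Embedding.inl)) ≤
      (prodBernoulli (hubWeight w (sides ({v} : Set V) ∅))).real
        (openConn (Sum.inr true) (Sum.inl b) ∩ SoloBlindKN.connTo (Sum.inr true) (A.map Function.Embedding.inl)) := by
  rw [real_hub_pre, real_hub_concl]
  have h1 : {ω : BondConfig V | ((openGraph ω).Reachable a b ∨
        ∃ s ∈ ({v} : Set V), ∃ s' ∈ ({v} : Set V), (openGraph ω).Reachable a s ∧ (openGraph ω).Reachable s' b) ∧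
        ∃ a' ∈ A, ∃ s ∈ ({v} : Set V), (openGraph ω).Reachable s a'} = openConn a b ∩ ⋃ a' ∈ A, openConn v a' := by
    ext ω
    simp only [mem_singleton_iff, exists_eq_left, mem_setOf_eq, mem_inter_iff, mem_iUnion, exists_prop, openConn]
    constructor
    · rintro ⟨h | ⟨hav, hvb⟩, a', ha', hva'⟩
      · exact ⟨h, a', ha', hva'⟩
      · exact ⟨hav.trans hvb, a', ha', hva'⟩
    · rintro ⟨h, a', ha', hva'⟩
      exact ⟨Or.inl h, a', ha', hva'⟩
  have h2 : {ω : BondConfig V | (∃ s ∈ ({v} : Set V), (openGraph ω).Reachable s b) ∧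
        ∃ a' ∈ A, ∃ s ∈ ({v} : Set V), (openGraph ω).Reachable s a'} = openConn v b ∩ ⋃ a' ∈ A, openConn v a' := by
    ext ω
    simp only [mem_singleton_iff, exists_eq_left, mem_setOf_eq, mem_inter_iff, mem_iUnion, exists_prop, openConn]
  rw [h1, h2]
  exact Q7Psi.kn_question7_fintype w A v b a haA hmin

/-- **The same with the Question-9 designation hypothesis** (reliabilities of the hub graph with the pairs at the hub closed,
`restrW {g}ᶜ`, as in `SoloBlindKN.knQuestion7_of_question9`): they are the reliabilities of `G` (`KnQ9Hub.real_restrW_hub`).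
[cite: KozmaNitzan2024, Question 9 (§5.5 p. 36)] -/
theorem question9_hub_singleton' (w : Sym2 V → unitInterval) (A : Finset V) (v b a : V) (haA : a ∈ A)
    (hmin : ∀ a' ∈ A,
      (prodBernoulli (restrW ({Sum.inr true}ᶜ : Set (V ⊕ Bool)) (hubWeight w (sides ({v} : Set V) ∅)))).real
          (openConn (Sum.inl a) (Sum.inl b)) ≤
        (prodBernoulli (restrW ({Sum.inr true}ᶜ : Set (V ⊕ Bool)) (hubWeight w (sides ({v} : Set V) ∅)))).real
          (openConn (Sum.inl a') (Sum.inl b))) :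
    (prodBernoulli (hubWeight w (sides ({v} : Set V) ∅))).real
        (openConn (Sum.inl a) (Sum.inl b) ∩ SoloBlindKN.connTo (Sum.inr true) (A.map Function.Embedding.inl)) ≤
      (prodBernoulli (hubWeight w (sides ({v} : Set V) ∅))).real
        (openConn (Sum.inr true) (Sum.inl b) ∩ SoloBlindKN.connTo (Sum.inr true) (A.map Function.Embedding.inl)) := by
  refine question9_hub_singleton w A v b a haA fun a' ha' => ?_
  have h := hmin a' ha'
  rwa [real_restrW_hub, real_restrW_hub] at h

end KnQ9Sure

end Summit.CriticalPhenomena.PercolationContinuityZ3.Theorems
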